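import Literature.Analysis.FluidPDE.SuitableWeakStability
import Literature.Analysis.FluidPDE.PeriodicLerayLimitLocalEnergy
import HarnessLib

/-!
# Suitability of limits of drift-regularised approximations (Leray's scheme ⇒ suitable limit)

Analysis/FluidPDE theorem file (theorems only, no definitions, no named facts). The drift twin of
the tree's stability theorem `isSuitableWeakSolutionOn_of_tendsto` (`SuitableWeakStability.lean`:
"a limit of suitable weak solutions is a suitable weak solution"), written for the proof that
**Leray's weak solutions are suitable** (Caffarelli–Kohn–Nirenberg 1982, Appendix: "the weak
solutions constructed by Leray are suitable"; Lemarié-Rieusset 2016, Thm. 12.2 and Prop. 14.3;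
Ożański–Pooley 2018, Thm. 6.37 with Lemma 6.34). Leray's regularised solutions solve the **drift**
system `∂ₜu + (b·∇)u = νΔu − ∇p`, `div u = div b = 0` with `b = J_ε u` (Leray 1934, (5.1)), for which
the tree has the weak identity and the local energy *equality* against space–time test functions
(`setIntegral_drift_weak_identity_of_contDiffOn`, `drift_local_energy_eq_of_contDiffOn`,
`ClassicalDriftSuitable.lean`). They are not solutions of the Navier–Stokes system itself, so the
tree's stability theorem (stated for suitable weak solutions) does not apply verbatim; this file
records the same passage to the limit with a drift:

* `tendsto_integral_norm_sq_mul_inner_drift` — the transport term with a drift,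
  `∫ ‖vₖ‖² ⟪bₖ, w⟫ → ∫ ‖u‖² ⟪u, w⟫` when `vₖ → u` and `bₖ → u` in `L³` (`‖vₖ‖² → ‖u‖²` in
  `L^{3/2}`, `⟪bₖ, w⟫ → ⟪u, w⟫` in `L³`, Hölder);
* `integrable_drift_lei_pieces`, `integral_integral_drift_lei_rhs_eq`,
  `tendsto_setIntegral_drift_lei_rhs` — integrability, iterated-vs-set integrals and convergence of
  the right-hand side `‖v‖²(∂ₜφ + νΔφ) + ‖v‖²⟪b, ∇φ⟫ + 2π⟪v, ∇φ⟫` of the drift local energy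
  inequality;
* `isSuitableWeakSolutionOn_of_drift_tendsto` — **the stability theorem with a drift**: on an open
  space–time region `Q` of finite measure let `(vₖ, bₖ, πₖ)` satisfy, for every `k`, the weak
  divergence condition, the drift weak identity
  `∫_Q (⟪vₖ, ∂ₜψ⟫ + ⟪vₖ, (bₖ·∇)ψ⟫ + ν⟪vₖ, Δψ⟫ + πₖ div ψ) = 0` and the drift local energy inequality
  `2ν ∫∫ |Gₖ|² φ ≤ ∫∫ (‖vₖ‖²(∂ₜφ + νΔφ) + ‖vₖ‖²⟪bₖ, ∇φ⟫ + 2πₖ⟪vₖ, ∇φ⟫)` (`Gₖ` measurable operator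
  fields, e.g. the classical gradients); if `vₖ → u` **and `bₖ → u`** in `L³(Q)`, `πₖ ⇀ p` weakly in
  `L^{3/2}(Q)` with bounded norms, `Gₖ a ⇀ G a` weakly in `L²(Q)` column by column with `G` a weak
  spatial gradient of `u`, `∫_Q |G|² < ∞`, and `u ∈ L^∞_t L²_x` locally, then `(u, p)` is a suitable
  weak solution of the Navier–Stokes equations on `Q` (viscosity `ν ≥ 0`, no force): the drift
  identity tends to the Navier–Stokes identity (`⟪vₖ, Dψ bₖ⟫ → ⟪u, Dψ u⟫`,
  `BradshawTsai2017.tendsto_integral_inner_clm_apply₂`), the right-hand sides of the local energy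
  inequalities converge and the left-hand sides are weakly lower semicontinuous
  (`lintegral_frobeniusNormSq_mul_le_of_tendsto`) — Leray 1934, §29–§31 / Ożański–Pooley 2018,
  proof of Thm. 6.37: "taking the limit in the local energy equality (6.84) for `u_{εₙ}` … gives the
  local energy inequality for `u`".

## Mathlib / tree search

Tree (all used): `isSuitableWeakSolutionOn_of_tendsto` and its tools
`tendsto_integral_inner_of_tendsto_eLpNorm_two_bdd`, `tendsto_integral_mul_inner_of_weak_strong`,
`lintegral_frobeniusNormSq_mul_le_of_tendsto`, `integral_integral_eq_setIntegral`,
`integrable_lei_pieces`, `integral_integral_lei_rhs_eq`, `integral_integral_frobeniusNormSq_mul_eq`,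
`IsSpaceTimeTestOn.exists_(scalar_)weights_bound`, `memLp_threeHalves_of_lintegral_le`,
`tendsto_eLpNorm_two_of_three`, `eLpNorm_norm_sq_threeHalves_le` (`SuitableWeakStability`);
`BradshawTsai2017.tendsto_integral_inner_clm_apply₂` (`PeriodicLerayLimitIdentity`),
`BradshawTsai2017.tendsto_eLpNorm_norm_sq_sub` (`PeriodicLerayLimitLocalEnergy`);
`FunctionSpaces.tendsto_integral_mul_mul`, `FunctionSpaces.tendsto_integral_mul_norm_sq`
(`LpPairingLimits`). `lean search 'drift.*tendsto|of_drift'`: nothing for the whole-space drift system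
(the periodic Bradshaw–Tsai files `PeriodicLerayLimit*` treat the `T`-periodic mollified system in
their own vocabulary) (2026-08-15).

## References

* J. Leray, Acta Math. 63 (1934), Ch. V §§26–31, (5.1), (5.3). [Leray1934]
* L. Caffarelli, R. Kohn, L. Nirenberg, CPAM 35 (1982), §2 (2.5) and Appendix.
  [CaffarelliKohnNirenberg1982]
* W. S. Ożański, B. C. Pooley, in: LMS Lecture Note Ser. 452 (2018) = arXiv:1708.09787, Lemma 6.34,
  Thm. 6.37. [OzanskiPooley2018]
* P. G. Lemarié-Rieusset, *The Navier–Stokes Problem in the 21st Century* (2016), Thm. 12.2,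
  Prop. 14.3. [LemarieRieusset2016]
* Z. Bradshaw, T.-P. Tsai, Analysis & PDE 12 (2019), §4.3. [BradshawTsai2019]
-/

noncomputable section

open MeasureTheory TopologicalSpace Set Function Filter Metric
open scoped ENNReal NNReal Topology InnerProductSpace RealInnerProductSpace Laplacian

namespace Literature.Analysis.FluidPDE

/-! ### The transport term with a drift -/

section Pairings

variable {X : Type*} [MeasurableSpace X] {μ : Measure X}
variable {E : Type*} [NormedAddCommGroup E] [InnerProductSpace ℝ E]

/-- **Cubic pairings with a drift pass to `L³` limits**: if `fₖ → g` and `bₖ → g` in `L³(μ)` and `w`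
is a bounded measurable field, then `∫ ‖fₖ‖² ⟪bₖ, w⟫ → ∫ ‖g‖² ⟪g, w⟫` (the transport term
`∫ |u|² (b·∇φ)` of the drift local energy inequality; `‖fₖ‖² → ‖g‖²` in `L^{3/2}`,
`⟪bₖ, w⟫ → ⟪g, w⟫` in `L³`, Hölder `(3/2, 3, 1)`). [folklore] -/
theorem tendsto_integral_norm_sq_mul_inner_drift {f b : ℕ → X → E} {g : X → E}
    (hf : ∀ k, MemLp (f k) 3 μ) (hb : ∀ k, MemLp (b k) 3 μ) (hg : MemLp g 3 μ)
    (hlimf : Tendsto (fun k => eLpNorm (f k - g) 3 μ) atTop (𝓝 0))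
    (hlimb : Tendsto (fun k => eLpNorm (b k - g) 3 μ) atTop (𝓝 0)) {w : X → E}
    (hw : AEStronglyMeasurable w μ) {C : ℝ} (hC : ∀ x, ‖w x‖ ≤ C) :
    Tendsto (fun k => ∫ x, ‖f k x‖ ^ 2 * ⟪b k x, w x⟫ ∂μ) atTop
      (𝓝 (∫ x, ‖g x‖ ^ 2 * ⟪g x, w x⟫ ∂μ)) := by
  have hAm : ∀ k, AEStronglyMeasurable (fun x => ‖f k x‖ ^ 2) μ := fun k =>
    ((hf k).1.norm.aemeasurable.pow_const 2).aestronglyMeasurable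
  have hA'm : AEStronglyMeasurable (fun x => ‖g x‖ ^ 2) μ :=
    (hg.1.norm.aemeasurable.pow_const 2).aestronglyMeasurable
  have hBm : ∀ k, AEStronglyMeasurable (fun x => ⟪b k x, w x⟫) μ := fun k => (hb k).1.inner hw
  have hB'm : AEStronglyMeasurable (fun x => ⟪g x, w x⟫) μ := hg.1.inner hw
  have hA' : eLpNorm (fun x => ‖g x‖ ^ 2) (3 / 2) μ < ⊤ :=
    (eLpNorm_norm_sq_threeHalves_le hg.1).trans_lt (ENNReal.mul_lt_top hg.2 hg.2)
  have hBw : ∀ {h : X → E}, AEStronglyMeasurable h μ →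
      eLpNorm (fun x => ⟪h x, w x⟫) 3 μ ≤ ENNReal.ofReal C * eLpNorm h 3 μ := fun {h} _ => by
    refine eLpNorm_le_mul_eLpNorm_of_ae_le_mul (Eventually.of_forall fun x => ?_) 3
    rw [mul_comm]
    exact (norm_inner_le_norm _ _).trans (mul_le_mul_of_nonneg_left (hC x) (norm_nonneg _))
  have hB' : eLpNorm (fun x => ⟪g x, w x⟫) 3 μ < ⊤ :=
    (hBw hg.1).trans_lt (ENNReal.mul_lt_top ENNReal.ofReal_lt_top hg.2)
  have hA : Tendsto (fun k => eLpNorm ((fun x => ‖f k x‖ ^ 2) - fun x => ‖g x‖ ^ 2) (3 / 2) μ)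
      atTop (𝓝 0) :=
    BradshawTsai2017.tendsto_eLpNorm_norm_sq_sub (fun k => (hf k).1) hg hlimf
  have hB : Tendsto (fun k => eLpNorm ((fun x => ⟪b k x, w x⟫) - fun x => ⟪g x, w x⟫) 3 μ)
      atTop (𝓝 0) := by
    have hbd : ∀ k, eLpNorm ((fun x => ⟪b k x, w x⟫) - fun x => ⟪g x, w x⟫) 3 μ ≤
        ENNReal.ofReal C * eLpNorm (b k - g) 3 μ := by
      intro k
      have e : ((fun x => ⟪b k x, w x⟫) - fun x => ⟪g x, w x⟫) = fun x => ⟪(b k - g) x, w x⟫ := by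
        funext x; simp only [Pi.sub_apply, inner_sub_left]
      rw [e]
      exact hBw ((hb k).1.sub hg.1)
    have h2 := ENNReal.Tendsto.const_mul (a := ENNReal.ofReal C) hlimb (Or.inr ENNReal.ofReal_ne_top)
    rw [mul_zero] at h2
    exact tendsto_of_tendsto_of_tendsto_of_le_of_le tendsto_const_nhds h2 (fun k => zero_le) hbd
  have key := FunctionSpaces.tendsto_integral_mul_mul hAm hA'm hBm hB'm hA' hB' hA hB
    (c := fun _ => (1 : ℝ)) aestronglyMeasurable_const (C := 1) (fun _ => by simp)
  simpa only [one_mul] using key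

end Pairings

/-! ### The right-hand side of the drift local energy inequality -/

section LocalEnergy

variable {E : Type*} [NormedAddCommGroup E] [InnerProductSpace ℝ E] [FiniteDimensional ℝ E]
  [MeasurableSpace E] [BorelSpace E]

/-- Integrability of the pieces of the right-hand side of the drift local energy inequality for
`w, b ∈ L³`, `q ∈ L^{3/2}` on a finite measure space and a scalar space–time test function `φ`:
`‖w‖² (∂ₜφ + νΔφ)`, `‖w‖² ⟪b, ∇φ⟫` and `q ⟪w, ∇φ⟫`. [folklore] -/
theorem integrable_drift_lei_pieces {μ : Measure (ℝ × E)} [IsFiniteMeasure μ] (ν : ℝ)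
    {Q : Opens (ℝ × E)} {φ : ℝ → E → ℝ} (hφ : IsSpaceTimeTestOn Q φ) {w b : ℝ → E → E}
    {q : ℝ → E → ℝ} (hw : MemLp (uncurry w) 3 μ) (hb : MemLp (uncurry b) 3 μ)
    (hq : MemLp (uncurry q) (3 / 2) μ) :
    Integrable (fun z : ℝ × E => ‖w z.1 z.2‖ ^ 2 * (timeDeriv φ z.1 z.2 + ν * Δ (φ z.1) z.2)) μ ∧
    Integrable (fun z : ℝ × E => ‖w z.1 z.2‖ ^ 2 * ⟪b z.1 z.2, gradient (φ z.1) z.2⟫) μ ∧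
    Integrable (fun z : ℝ × E => q z.1 z.2 * ⟪w z.1 z.2, gradient (φ z.1) z.2⟫) μ := by
  have hT := FunctionSpaces.holderTriple_threeHalves_three
  obtain ⟨iA, -, iC⟩ := integrable_lei_pieces ν hφ hw hq
  refine ⟨iA, ?_, iC⟩
  obtain ⟨C, -, -, -, hgC, -⟩ := hφ.exists_scalar_weights_bound
  have hgm : AEStronglyMeasurable (fun z : ℝ × E => gradient (φ z.1) z.2) μ :=
    hφ.continuous_slice_gradient.aestronglyMeasurable
  have hB : MemLp (fun z : ℝ × E => ⟪b z.1 z.2, gradient (φ z.1) z.2⟫) 3 μ := by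
    refine ⟨hb.1.inner hgm, ?_⟩
    have hle : eLpNorm (fun z : ℝ × E => ⟪b z.1 z.2, gradient (φ z.1) z.2⟫) 3 μ ≤
        ENNReal.ofReal C * eLpNorm (uncurry b) 3 μ :=
      eLpNorm_le_mul_eLpNorm_of_ae_le_mul (Eventually.of_forall fun z => by
        rw [mul_comm]
        exact (norm_inner_le_norm _ _).trans (mul_le_mul_of_nonneg_left (hgC z) (norm_nonneg _))) 3
    exact hle.trans_lt (ENNReal.mul_lt_top ENNReal.ofReal_lt_top hb.2)
  have hA : MemLp (fun z : ℝ × E => ‖w z.1 z.2‖ ^ 2) (3 / 2) μ :=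
    ⟨(hw.1.norm.aemeasurable.pow_const 2).aestronglyMeasurable,
      (eLpNorm_norm_sq_threeHalves_le hw.1).trans_lt (ENNReal.mul_lt_top hw.2 hw.2)⟩
  exact hA.integrable_mul hB

/-- Splitting of the integral of the right-hand side of the drift local energy inequality into its
three pieces. [folklore] -/
theorem integral_drift_lei_rhs_split {μ : Measure (ℝ × E)} [IsFiniteMeasure μ] (ν : ℝ)
    {Q : Opens (ℝ × E)} {φ : ℝ → E → ℝ} (hφ : IsSpaceTimeTestOn Q φ) {w b : ℝ → E → E}
    {q : ℝ → E → ℝ} (hw : MemLp (uncurry w) 3 μ) (hb : MemLp (uncurry b) 3 μ)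
    (hq : MemLp (uncurry q) (3 / 2) μ) :
    ∫ z, (‖w z.1 z.2‖ ^ 2 * (timeDeriv φ z.1 z.2 + ν * Δ (φ z.1) z.2) +
        ‖w z.1 z.2‖ ^ 2 * ⟪b z.1 z.2, gradient (φ z.1) z.2⟫ +
        2 * q z.1 z.2 * ⟪w z.1 z.2, gradient (φ z.1) z.2⟫) ∂μ =
      (∫ z, (timeDeriv φ z.1 z.2 + ν * Δ (φ z.1) z.2) * ‖w z.1 z.2‖ ^ 2 ∂μ) +
        ((∫ z, ‖w z.1 z.2‖ ^ 2 * ⟪b z.1 z.2, gradient (φ z.1) z.2⟫ ∂μ) +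
          2 * ∫ z, q z.1 z.2 * ⟪w z.1 z.2, gradient (φ z.1) z.2⟫ ∂μ) := by
  obtain ⟨iA, iB, iC⟩ := integrable_drift_lei_pieces ν hφ hw hb hq
  have iA' : Integrable (fun z : ℝ × E => (timeDeriv φ z.1 z.2 + ν * Δ (φ z.1) z.2) *
      ‖w z.1 z.2‖ ^ 2) μ := iA.congr (Eventually.of_forall fun z => mul_comm _ _)
  have iC2 : Integrable (fun z : ℝ × E => 2 * (q z.1 z.2 * ⟪w z.1 z.2, gradient (φ z.1) z.2⟫)) μ :=
    iC.const_mul 2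
  have iBC : Integrable (fun z : ℝ × E => ‖w z.1 z.2‖ ^ 2 * ⟪b z.1 z.2, gradient (φ z.1) z.2⟫ +
      2 * (q z.1 z.2 * ⟪w z.1 z.2, gradient (φ z.1) z.2⟫)) μ := iB.add iC2
  have e1 := integral_add iA' iBC
  have e2 := integral_add iB iC2
  have e3 := integral_const_mul (μ := μ) (2 : ℝ)
    (fun z : ℝ × E => q z.1 z.2 * ⟪w z.1 z.2, gradient (φ z.1) z.2⟫)
  rw [← e3, ← e2, ← e1]
  refine integral_congr_ae (Eventually.of_forall fun z => ?_)
  ring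

/-- The iterated integral of the right-hand side of the drift local energy inequality over `ℝ × E`
is the integral over `Q`, for `w, b ∈ L³(Q)`, `q ∈ L^{3/2}(Q)`, `|Q| < ∞` (all weights vanish off
`Q`). [folklore] -/
theorem integral_integral_drift_lei_rhs_eq {Q : Opens (ℝ × E)} (hQ : volume (Q : Set (ℝ × E)) ≠ ∞)
    (ν : ℝ) {w b : ℝ → E → E} {q : ℝ → E → ℝ}
    (hw : MemLp (uncurry w) 3 (volume.restrict (Q : Set (ℝ × E))))
    (hb : MemLp (uncurry b) 3 (volume.restrict (Q : Set (ℝ × E))))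
    (hq : MemLp (uncurry q) (3 / 2) (volume.restrict (Q : Set (ℝ × E))))
    {φ : ℝ → E → ℝ} (hφ : IsSpaceTimeTestOn Q φ) :
    ∫ t, ∫ x, (‖w t x‖ ^ 2 * (timeDeriv φ t x + ν * Δ (φ t) x) +
        ‖w t x‖ ^ 2 * ⟪b t x, gradient (φ t) x⟫ + 2 * q t x * ⟪w t x, gradient (φ t) x⟫) =
      ∫ z in (Q : Set (ℝ × E)), (‖w z.1 z.2‖ ^ 2 * (timeDeriv φ z.1 z.2 + ν * Δ (φ z.1) z.2) +
        ‖w z.1 z.2‖ ^ 2 * ⟪b z.1 z.2, gradient (φ z.1) z.2⟫ +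
        2 * q z.1 z.2 * ⟪w z.1 z.2, gradient (φ z.1) z.2⟫) := by
  set S : Set (ℝ × E) := (Q : Set (ℝ × E)) with hS
  haveI : IsFiniteMeasure (volume.restrict S) :=
    ⟨by rw [Measure.restrict_apply_univ]; exact hQ.lt_top⟩
  obtain ⟨iA, iB, iC⟩ := integrable_drift_lei_pieces ν hφ hw hb hq
  have hRint : IntegrableOn (fun z : ℝ × E => ‖w z.1 z.2‖ ^ 2 * (timeDeriv φ z.1 z.2 +
      ν * Δ (φ z.1) z.2) + ‖w z.1 z.2‖ ^ 2 * ⟪b z.1 z.2, gradient (φ z.1) z.2⟫ +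
      2 * q z.1 z.2 * ⟪w z.1 z.2, gradient (φ z.1) z.2⟫) S volume := by
    have h := iA.add (iB.add (iC.const_mul 2))
    refine h.congr (Eventually.of_forall fun z => ?_)
    simp only [Pi.add_apply]
    ring
  have hR0 : ∀ z : ℝ × E, z ∉ S → ‖w z.1 z.2‖ ^ 2 * (timeDeriv φ z.1 z.2 + ν * Δ (φ z.1) z.2) +
      ‖w z.1 z.2‖ ^ 2 * ⟪b z.1 z.2, gradient (φ z.1) z.2⟫ +
      2 * q z.1 z.2 * ⟪w z.1 z.2, gradient (φ z.1) z.2⟫ = 0 := by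
    intro z hz
    have h1 : deriv (fun s => φ s z.2) z.1 = 0 := hφ.deriv_eq_zero hz
    have h2 : Δ (φ z.1) z.2 = 0 := hφ.laplacian_slice_eq_zero hz
    have h3 : gradient (φ z.1) z.2 = 0 := by
      rw [gradient, hφ.fderiv_slice_eq_zero hz, map_zero]
    simp [h1, h2, h3]
  exact integral_integral_eq_setIntegral hRint hR0

/-- **Convergence of the right-hand side of the drift local energy inequality** along `vₖ → u`,
`bₖ → u` in `L³`, `πₖ ⇀ p` weakly in `L^{3/2}` with bounded norms (Ożański–Pooley 2018, proof of
Thm. 6.37: "taking the limit in the local energy equality (6.84)"; the argument of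
`tendsto_setIntegral_lei_rhs` with the drift transport term). [cite: OzanskiPooley2018, Thm. 6.37 (proof)] -/
theorem tendsto_setIntegral_drift_lei_rhs {μ : Measure (ℝ × E)} [IsFiniteMeasure μ] (ν : ℝ)
    {Q : Opens (ℝ × E)} {φ : ℝ → E → ℝ} (hφ : IsSpaceTimeTestOn Q φ)
    {v b : ℕ → ℝ → E → E} {π : ℕ → ℝ → E → ℝ} {u : ℝ → E → E} {p : ℝ → E → ℝ} {M : ℝ≥0∞}
    (hM : M ≠ ⊤) (hv : ∀ k, MemLp (uncurry (v k)) 3 μ) (hb : ∀ k, MemLp (uncurry (b k)) 3 μ)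
    (hu : MemLp (uncurry u) 3 μ)
    (hconv : Tendsto (fun k => eLpNorm (uncurry (v k) - uncurry u) 3 μ) atTop (𝓝 0))
    (hconvb : Tendsto (fun k => eLpNorm (uncurry (b k) - uncurry u) 3 μ) atTop (𝓝 0))
    (hπm : ∀ k, AEStronglyMeasurable (uncurry (π k)) μ)
    (hπM : ∀ k, eLpNorm (uncurry (π k)) (3 / 2) μ ≤ M) (hp : MemLp (uncurry p) (3 / 2) μ)
    (hπw : ∀ g : ℝ × E → ℝ, MemLp g 3 μ →
      Tendsto (fun k => ∫ z, π k z.1 z.2 * g z ∂μ) atTop (𝓝 (∫ z, p z.1 z.2 * g z ∂μ))) :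
    Tendsto (fun k => ∫ z, (‖v k z.1 z.2‖ ^ 2 * (timeDeriv φ z.1 z.2 + ν * Δ (φ z.1) z.2) +
        ‖v k z.1 z.2‖ ^ 2 * ⟪b k z.1 z.2, gradient (φ z.1) z.2⟫ +
        2 * π k z.1 z.2 * ⟪v k z.1 z.2, gradient (φ z.1) z.2⟫) ∂μ) atTop
      (𝓝 (∫ z, (‖u z.1 z.2‖ ^ 2 * (timeDeriv φ z.1 z.2 + ν * Δ (φ z.1) z.2) +
        ‖u z.1 z.2‖ ^ 2 * ⟪u z.1 z.2, gradient (φ z.1) z.2⟫ +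
        2 * p z.1 z.2 * ⟪u z.1 z.2, gradient (φ z.1) z.2⟫) ∂μ)) := by
  obtain ⟨C, hC0, -, htC, hgC, hΔC⟩ := hφ.exists_scalar_weights_bound
  have h23 : (2 : ℝ≥0∞) ≤ 3 := by norm_num
  have htm : AEStronglyMeasurable (fun z : ℝ × E => timeDeriv φ z.1 z.2) μ :=
    hφ.continuous_timeDeriv.aestronglyMeasurable
  have hΔm : AEStronglyMeasurable (fun z : ℝ × E => Δ (φ z.1) z.2) μ :=
    hφ.continuous_laplacian_slice.aestronglyMeasurable
  have hgm : AEStronglyMeasurable (fun z : ℝ × E => gradient (φ z.1) z.2) μ :=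
    hφ.continuous_slice_gradient.aestronglyMeasurable
  have hcm : AEStronglyMeasurable (fun z : ℝ × E => timeDeriv φ z.1 z.2 + ν * Δ (φ z.1) z.2) μ :=
    htm.add (hΔm.const_mul ν)
  have hcb : ∀ z : ℝ × E, ‖timeDeriv φ z.1 z.2 + ν * Δ (φ z.1) z.2‖ ≤ C + ‖ν‖ * C := fun z =>
    calc ‖timeDeriv φ z.1 z.2 + ν * Δ (φ z.1) z.2‖
        ≤ ‖timeDeriv φ z.1 z.2‖ + ‖ν * Δ (φ z.1) z.2‖ := norm_add_le _ _
      _ ≤ C + ‖ν‖ * C := by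
          rw [norm_mul]
          exact add_le_add (htC z) (mul_le_mul_of_nonneg_left (hΔC z) (norm_nonneg _))
  have hlimA := FunctionSpaces.tendsto_integral_mul_norm_sq (μ := μ) (fun k => (hv k).1)
    (hu.mono_exponent h23) (tendsto_eLpNorm_two_of_three (fun k => (hv k).1.sub hu.1) hconv) hcm
    (by positivity) hcb
  have hlimB := tendsto_integral_norm_sq_mul_inner_drift (μ := μ) hv hb hu hconv hconvb hgm hgC
  have hlimC := tendsto_integral_mul_inner_of_weak_strong (μ := μ) (π := fun k => uncurry (π k))
    (p := uncurry p) hM hπm hπM hπw hv hu hconv hgm hgC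
  have hlim := hlimA.add (hlimB.add (hlimC.const_mul 2))
  rw [integral_drift_lei_rhs_split ν hφ hu hu hp]
  refine hlim.congr fun k => ?_
  rw [integral_drift_lei_rhs_split ν hφ (hv k) (hb k) ⟨hπm k, (hπM k).trans_lt hM.lt_top⟩]
  rfl

end LocalEnergy

/-! ### The stability theorem with a drift -/

section Stability

variable {E : Type*} [NormedAddCommGroup E] [InnerProductSpace ℝ E] [FiniteDimensional ℝ E]
  [MeasurableSpace E] [BorelSpace E]

/-- **Limits of drift-regularised approximations are suitable weak solutions** (Leray 1934,
§§29–31; Caffarelli–Kohn–Nirenberg 1982, Appendix; Ożański–Pooley 2018, Thm. 6.37 with Lemma 6.34;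
Lemarié-Rieusset 2016, Thm. 12.2). Let `Q` be an open space–time region of finite measure and, for
every `k`, let `(vₖ, bₖ, πₖ)` satisfy on `Q`: the weak divergence condition `∫_Q ⟪vₖ, ∇θ⟫ = 0`, the
drift weak identity `∫_Q (⟪vₖ, ∂ₜψ⟫ + ⟪vₖ, (bₖ·∇)ψ⟫ + ν⟪vₖ, Δψ⟫ + πₖ div ψ) = 0` for all test fields
`ψ` on `Q`, and the drift local energy inequality
`2ν ∫∫ |Gₖ|² φ ≤ ∫∫ (‖vₖ‖² (∂ₜφ + νΔφ) + ‖vₖ‖² ⟪bₖ, ∇φ⟫ + 2πₖ ⟪vₖ, ∇φ⟫)` for all nonnegative test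
functions `φ` on `Q` (with `|Gₖ|² φ` integrable on `Q`; `Gₖ` measurable operator fields — for
Leray's regularised solutions the classical gradients, and the three identities are
`setIntegral_drift_weak_identity_of_contDiffOn` / `drift_local_energy_eq_of_contDiffOn`). Assume
`vₖ, bₖ ∈ L³(Q)`, `∫_Q |πₖ|^{3/2} ≤ C_p`; `vₖ → u` and `bₖ → u` in `L³(Q)`; `πₖ ⇀ p` weakly in
`L^{3/2}(Q)` (pairings with `L³(Q)` converge) with `∫_Q |p|^{3/2} ≤ C_p`; `Gₖ a ⇀ G a` weakly in
`L²(Q; E)` for every direction `a`, where `G` is a weak spatial gradient of `u` on `Q` with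
`∫_Q |G|² < ∞`; and `u ∈ L^∞_t L²_x` on compact subsets of `Q`. Then `(u, p)` is a suitable weak
solution of the Navier–Stokes equations on `Q` (viscosity `ν ≥ 0`, no force).
[cite: OzanskiPooley2018, Thm. 6.37 (proof) and Lemma 6.34] [cite: CaffarelliKohnNirenberg1982, Appendix] [cite: Leray1934, Ch. V §§29–31] -/
theorem isSuitableWeakSolutionOn_of_drift_tendsto {Q : Opens (ℝ × E)}
    (hQ : volume (Q : Set (ℝ × E)) ≠ ∞) {ν : ℝ} (hν : 0 ≤ ν)
    {v b : ℕ → ℝ → E → E} {π : ℕ → ℝ → E → ℝ} {G : ℕ → ℝ → E → E →L[ℝ] E}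
    {u : ℝ → E → E} {p : ℝ → E → ℝ} {Gu : ℝ → E → E →L[ℝ] E} {Cp : ℝ≥0∞} (hCp : Cp ≠ ∞)
    (hdivk : ∀ (k : ℕ) (θ : ℝ → E → ℝ), IsSpaceTimeTestOn Q θ →
      ∫ z in (Q : Set (ℝ × E)), ⟪v k z.1 z.2, gradient (θ z.1) z.2⟫ = 0)
    (hmomk : ∀ (k : ℕ) (ψ : ℝ → E → E), IsSpaceTimeTestOn Q ψ →
      ∫ z in (Q : Set (ℝ × E)), (⟪v k z.1 z.2, timeDeriv ψ z.1 z.2⟫ +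
        ⟪v k z.1 z.2, convect (b k z.1) (ψ z.1) z.2⟫ + ν * ⟪v k z.1 z.2, Δ (ψ z.1) z.2⟫ +
        π k z.1 z.2 * VectorCalculus.divergence (ψ z.1) z.2) = 0)
    (hleik : ∀ (k : ℕ) (φ : ℝ → E → ℝ), IsSpaceTimeTestOn Q φ → (∀ t x, 0 ≤ φ t x) →
      IntegrableOn (fun z : ℝ × E => frobeniusNormSq (G k z.1 z.2) * φ z.1 z.2)
          (Q : Set (ℝ × E)) volume ∧
        2 * ν * ∫ t, ∫ x, frobeniusNormSq (G k t x) * φ t x ≤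
          ∫ t, ∫ x, (‖v k t x‖ ^ 2 * (timeDeriv φ t x + ν * Δ (φ t) x) +
            ‖v k t x‖ ^ 2 * ⟪b k t x, gradient (φ t) x⟫ +
            2 * π k t x * ⟪v k t x, gradient (φ t) x⟫))
    (hGm : ∀ k, AEStronglyMeasurable (uncurry (G k)) (volume.restrict (Q : Set (ℝ × E))))
    (hv3 : ∀ k, MemLp (uncurry (v k)) 3 (volume.restrict (Q : Set (ℝ × E))))
    (hb3 : ∀ k, MemLp (uncurry (b k)) 3 (volume.restrict (Q : Set (ℝ × E))))
    (hπm : ∀ k, AEStronglyMeasurable (uncurry (π k)) (volume.restrict (Q : Set (ℝ × E))))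
    (hπb : ∀ k, ∫⁻ z in (Q : Set (ℝ × E)), ‖π k z.1 z.2‖ₑ ^ (3 / 2 : ℝ) ≤ Cp)
    (hu3 : MemLp (uncurry u) 3 (volume.restrict (Q : Set (ℝ × E))))
    (hpm : AEStronglyMeasurable (uncurry p) (volume.restrict (Q : Set (ℝ × E))))
    (hpb : ∫⁻ z in (Q : Set (ℝ × E)), ‖p z.1 z.2‖ₑ ^ (3 / 2 : ℝ) ≤ Cp)
    (hGu : HasWeakSpatialGradientOn Q u Gu)
    (hGu2 : ∫⁻ z in (Q : Set (ℝ × E)), ENNReal.ofReal (frobeniusNormSq (Gu z.1 z.2)) < ∞)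
    (huE : ∀ K ⊆ (Q : Set (ℝ × E)), IsCompact K → ∃ C : ℝ≥0, ∀ᵐ t : ℝ,
      ∫⁻ x, K.indicator (fun z : ℝ × E => ‖u z.1 z.2‖ₑ ^ 2) (t, x) ≤ C)
    (hconv : Tendsto (fun k => eLpNorm (uncurry (v k) - uncurry u) 3
      (volume.restrict (Q : Set (ℝ × E)))) atTop (𝓝 0))
    (hconvb : Tendsto (fun k => eLpNorm (uncurry (b k) - uncurry u) 3
      (volume.restrict (Q : Set (ℝ × E)))) atTop (𝓝 0))
    (hπw : ∀ g : ℝ × E → ℝ, MemLp g 3 (volume.restrict (Q : Set (ℝ × E))) →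
      Tendsto (fun k => ∫ z in (Q : Set (ℝ × E)), π k z.1 z.2 * g z) atTop
        (𝓝 (∫ z in (Q : Set (ℝ × E)), p z.1 z.2 * g z)))
    (hGw : ∀ (a : E) (h : ℝ × E → E), MemLp h 2 (volume.restrict (Q : Set (ℝ × E))) →
      Tendsto (fun k => ∫ z in (Q : Set (ℝ × E)), ⟪G k z.1 z.2 a, h z⟫) atTop
        (𝓝 (∫ z in (Q : Set (ℝ × E)), ⟪Gu z.1 z.2 a, h z⟫))) :
    IsSuitableWeakSolutionOn Q ν 0 u p := by
  set S : Set (ℝ × E) := (Q : Set (ℝ × E)) with hS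
  have hSm : MeasurableSet S := Q.isOpen.measurableSet
  set μQ : Measure (ℝ × E) := volume.restrict S with hμQ
  haveI : IsFiniteMeasure μQ := ⟨by rw [hμQ, Measure.restrict_apply_univ]; exact hQ.lt_top⟩
  have h13 : (1 : ℝ≥0∞) ≤ 3 := by norm_num
  have h23 : (2 : ℝ≥0∞) ≤ 3 := by norm_num
  have h132 : (1 : ℝ≥0∞) ≤ 3 / 2 := FunctionSpaces.ennreal_one_le_three_halves
  -- memberships
  have hv2 : ∀ k, MemLp (uncurry (v k)) 2 μQ := fun k => (hv3 k).mono_exponent h23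
  have hb2 : ∀ k, MemLp (uncurry (b k)) 2 μQ := fun k => (hb3 k).mono_exponent h23
  have hu2 : MemLp (uncurry u) 2 μQ := hu3.mono_exponent h23
  have hu1 : Integrable (uncurry u) μQ := hu3.integrable h13
  have hconv2 : Tendsto (fun k => eLpNorm (uncurry (v k) - uncurry u) 2 μQ) atTop (𝓝 0) :=
    tendsto_eLpNorm_two_of_three (fun k => (hv3 k).1.sub hu3.1) hconv
  have hconvb2 : Tendsto (fun k => eLpNorm (uncurry (b k) - uncurry u) 2 μQ) atTop (𝓝 0) :=
    tendsto_eLpNorm_two_of_three (fun k => (hb3 k).1.sub hu3.1) hconvb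
  have hπmem : ∀ k, MemLp (uncurry (π k)) (3 / 2) μQ ∧
      eLpNorm (uncurry (π k)) (3 / 2) μQ ≤ Cp ^ (1 / (3 / 2 : ℝ)) := fun k =>
    memLp_threeHalves_of_lintegral_le (hπm k) hCp (hπb k)
  have hpmem := memLp_threeHalves_of_lintegral_le hpm hCp hpb
  have hMt : Cp ^ (1 / (3 / 2 : ℝ)) ≠ ⊤ := ENNReal.rpow_ne_top_of_nonneg (by norm_num) hCp
  have hp1 : Integrable (uncurry p) μQ := hpmem.1.integrable h132
  have hπ1 : ∀ k, Integrable (uncurry (π k)) μQ := fun k => (hπmem k).1.integrable h132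
  ------------------------------------------------------------------
  -- (1) the distributional equations
  ------------------------------------------------------------------
  have hdist : IsDistributionalNSSolutionOn Q ν 0 u p := by
    refine ⟨IntegrableOn.locallyIntegrableOn hu1, ?_, IntegrableOn.locallyIntegrableOn hp1,
      fun θ hθ => ?_, fun ψ hψ => ?_⟩
    · exact IntegrableOn.locallyIntegrableOn ((memLp_two_iff_integrable_sq_norm hu2.1).1 hu2)
    · -- divergence free
      obtain ⟨C, hC0, -, -, hgC, -⟩ := hθ.exists_scalar_weights_bound
      have hw : AEStronglyMeasurable (fun z : ℝ × E => gradient (θ z.1) z.2) μQ :=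
        hθ.continuous_slice_gradient.aestronglyMeasurable
      have hlim : Tendsto (fun k => ∫ z, ⟪uncurry (v k) z, gradient (θ z.1) z.2⟫ ∂μQ) atTop
          (𝓝 (∫ z, ⟪uncurry u z, gradient (θ z.1) z.2⟫ ∂μQ)) :=
        tendsto_integral_inner_of_tendsto_eLpNorm_two_bdd hv2 hu2 hconv2 hw hC0 hgC
      have h0 : ∀ k, ∫ z, ⟪uncurry (v k) z, gradient (θ z.1) z.2⟫ ∂μQ = 0 := fun k =>
        hdivk k θ hθ
      simp only [h0] at hlim
      exact (tendsto_nhds_unique tendsto_const_nhds hlim).symm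
    · -- the momentum equation
      obtain ⟨C, hC0, htC, hDC, hΔC, hdivC⟩ := hψ.exists_weights_bound
      have htm : AEStronglyMeasurable (fun z : ℝ × E => timeDeriv ψ z.1 z.2) μQ :=
        hψ.continuous_timeDeriv.aestronglyMeasurable
      have hDm : AEStronglyMeasurable (fun z : ℝ × E => fderiv ℝ (ψ z.1) z.2) μQ :=
        hψ.continuous_fderiv_slice.aestronglyMeasurable
      have hΔm : AEStronglyMeasurable (fun z : ℝ × E => Δ (ψ z.1) z.2) μQ :=
        hψ.continuous_laplacian_slice.aestronglyMeasurable
      have hdivm : AEStronglyMeasurable (fun z : ℝ × E => VectorCalculus.divergence (ψ z.1) z.2) μQ :=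
        hψ.continuous_divergence_slice.aestronglyMeasurable
      have hdiv3 : MemLp (fun z : ℝ × E => VectorCalculus.divergence (ψ z.1) z.2) 3 μQ :=
        (memLp_top_of_bound hdivm C (Eventually.of_forall hdivC)).mono_exponent le_top
      have happ : Continuous (uncurry fun (T : E →L[ℝ] E) (x : E) => T x) :=
        isBoundedBilinearMap_apply.continuous
      -- splitting of the tested drift integrand
      have hsplit : ∀ {w b' : ℝ → E → E} {q : ℝ → E → ℝ}, MemLp (uncurry w) 2 μQ →
          MemLp (uncurry b') 2 μQ → Integrable (uncurry q) μQ →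
          ∫ z, (⟪w z.1 z.2, timeDeriv ψ z.1 z.2⟫ + ⟪w z.1 z.2, convect (b' z.1) (ψ z.1) z.2⟫ +
            ν * ⟪w z.1 z.2, Δ (ψ z.1) z.2⟫ + q z.1 z.2 * VectorCalculus.divergence (ψ z.1) z.2) ∂μQ =
          ((∫ z, ⟪uncurry w z, timeDeriv ψ z.1 z.2⟫ ∂μQ) +
            ∫ z, ⟪uncurry w z, fderiv ℝ (ψ z.1) z.2 (uncurry b' z)⟫ ∂μQ) +
          (ν * ∫ z, ⟪uncurry w z, Δ (ψ z.1) z.2⟫ ∂μQ +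
            ∫ z, uncurry q z * VectorCalculus.divergence (ψ z.1) z.2 ∂μQ) := by
        intro w b' q hw hb' hq
        have hw1 : Integrable (uncurry w) μQ := hw.integrable one_le_two
        have hbd : ∀ {g : ℝ × E → E}, AEStronglyMeasurable g μQ → (∀ z, ‖g z‖ ≤ C) →
            Integrable (fun z => ⟪uncurry w z, g z⟫) μQ := fun {g} hg hgC => by
          refine (hw1.norm.mul_const C).mono' (hw.1.inner hg) (Eventually.of_forall fun z => ?_)
          exact (norm_inner_le_norm _ _).trans (mul_le_mul_of_nonneg_left (hgC z) (norm_nonneg _))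
        have i1 := hbd htm htC
        have i2 : Integrable (fun z => ⟪uncurry w z, fderiv ℝ (ψ z.1) z.2 (uncurry b' z)⟫) μQ := by
          have hm : AEStronglyMeasurable (fun z => fderiv ℝ (ψ z.1) z.2 (uncurry b' z)) μQ :=
            happ.comp_aestronglyMeasurable₂ hDm hb'.1
          have h2 : Integrable (fun z => ‖uncurry w z‖ * ‖uncurry b' z‖) μQ :=
            hw.norm.integrable_mul hb'.norm
          refine (h2.const_mul C).mono' (hw.1.inner hm) (Eventually.of_forall fun z => ?_)
          calc ‖⟪uncurry w z, fderiv ℝ (ψ z.1) z.2 (uncurry b' z)⟫‖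
              ≤ ‖uncurry w z‖ * ‖fderiv ℝ (ψ z.1) z.2 (uncurry b' z)‖ := norm_inner_le_norm _ _
            _ ≤ ‖uncurry w z‖ * (C * ‖uncurry b' z‖) := by
                gcongr
                exact (ContinuousLinearMap.le_opNorm _ _).trans
                  (mul_le_mul_of_nonneg_right (hDC z) (norm_nonneg _))
            _ = C * (‖uncurry w z‖ * ‖uncurry b' z‖) := by ring
        have i3 : Integrable (fun z => ν * ⟪uncurry w z, Δ (ψ z.1) z.2⟫) μQ := (hbd hΔm hΔC).const_mul ν
        have i4 : Integrable (fun z => uncurry q z * VectorCalculus.divergence (ψ z.1) z.2) μQ :=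
          (hq.bdd_mul hdivm (Eventually.of_forall hdivC)).congr
            (Eventually.of_forall fun z => mul_comm _ _)
        have i12 : Integrable (fun z => ⟪uncurry w z, timeDeriv ψ z.1 z.2⟫ +
            ⟪uncurry w z, fderiv ℝ (ψ z.1) z.2 (uncurry b' z)⟫) μQ := i1.add i2
        have i34 : Integrable (fun z => ν * ⟪uncurry w z, Δ (ψ z.1) z.2⟫ +
            uncurry q z * VectorCalculus.divergence (ψ z.1) z.2) μQ := i3.add i4
        have e1 := integral_add i1 i2
        have e2 := integral_add i3 i4
        have e12 := integral_add i12 i34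
        have e3 := integral_const_mul (μ := μQ) ν (fun z : ℝ × E => ⟪uncurry w z, Δ (ψ z.1) z.2⟫)
        rw [← e3, ← e1, ← e2, ← e12]
        refine integral_congr_ae (Eventually.of_forall fun z => ?_)
        simp only [convect, uncurry]
        ring
      -- the limits of the four pieces
      have hl1 : Tendsto (fun k => ∫ z, ⟪uncurry (v k) z, timeDeriv ψ z.1 z.2⟫ ∂μQ) atTop
          (𝓝 (∫ z, ⟪uncurry u z, timeDeriv ψ z.1 z.2⟫ ∂μQ)) :=
        tendsto_integral_inner_of_tendsto_eLpNorm_two_bdd hv2 hu2 hconv2 htm hC0 htC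
      have hl2 : Tendsto (fun k => ∫ z, ⟪uncurry (v k) z, fderiv ℝ (ψ z.1) z.2 (uncurry (b k) z)⟫ ∂μQ)
          atTop (𝓝 (∫ z, ⟪uncurry u z, fderiv ℝ (ψ z.1) z.2 (uncurry u z)⟫ ∂μQ)) :=
        BradshawTsai2017.tendsto_integral_inner_clm_apply₂ hv2 hu2 hb2 hu2 hconv2 hconvb2 hDm hC0 hDC
      have hl3 : Tendsto (fun k => ν * ∫ z, ⟪uncurry (v k) z, Δ (ψ z.1) z.2⟫ ∂μQ) atTop
          (𝓝 (ν * ∫ z, ⟪uncurry u z, Δ (ψ z.1) z.2⟫ ∂μQ)) :=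
        (tendsto_integral_inner_of_tendsto_eLpNorm_two_bdd hv2 hu2 hconv2 hΔm hC0 hΔC).const_mul ν
      have hl4 : Tendsto (fun k => ∫ z, uncurry (π k) z * VectorCalculus.divergence (ψ z.1) z.2 ∂μQ)
          atTop (𝓝 (∫ z, uncurry p z * VectorCalculus.divergence (ψ z.1) z.2 ∂μQ)) :=
        hπw _ hdiv3
      have hlim := (hl1.add hl2).add (hl3.add hl4)
      have hk : ∀ k, ((∫ z, ⟪uncurry (v k) z, timeDeriv ψ z.1 z.2⟫ ∂μQ) +
          ∫ z, ⟪uncurry (v k) z, fderiv ℝ (ψ z.1) z.2 (uncurry (b k) z)⟫ ∂μQ) +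
          (ν * ∫ z, ⟪uncurry (v k) z, Δ (ψ z.1) z.2⟫ ∂μQ +
            ∫ z, uncurry (π k) z * VectorCalculus.divergence (ψ z.1) z.2 ∂μQ) = 0 := fun k => by
        rw [← hsplit (hv2 k) (hb2 k) (hπ1 k)]
        exact hmomk k ψ hψ
      simp only [hk] at hlim
      have h := tendsto_nhds_unique tendsto_const_nhds hlim
      -- the limit identity, with the (vanishing) force term
      have e0 : ∫ z, (⟪u z.1 z.2, timeDeriv ψ z.1 z.2⟫ + ⟪u z.1 z.2, convect (u z.1) (ψ z.1) z.2⟫ +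
          ν * ⟪u z.1 z.2, Δ (ψ z.1) z.2⟫ + p z.1 z.2 * VectorCalculus.divergence (ψ z.1) z.2 +
          ⟪(0 : ℝ → E → E) z.1 z.2, ψ z.1 z.2⟫) ∂μQ =
          ∫ z, (⟪u z.1 z.2, timeDeriv ψ z.1 z.2⟫ + ⟪u z.1 z.2, convect (u z.1) (ψ z.1) z.2⟫ +
          ν * ⟪u z.1 z.2, Δ (ψ z.1) z.2⟫ + p z.1 z.2 * VectorCalculus.divergence (ψ z.1) z.2) ∂μQ := by
        refine integral_congr_ae (Eventually.of_forall fun z => ?_)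
        simp only [Pi.zero_apply, inner_zero_left, add_zero]
      rw [e0, hsplit hu2 hu2 hp1]
      exact h.symm
  ------------------------------------------------------------------
  -- (2)–(4) the classes and the local energy inequality
  ------------------------------------------------------------------
  refine
    { distributional := hdist
      energyClass := huE
      pressure := fun K hK _ => (lintegral_mono_set hK).trans_lt (hpb.trans_lt hCp.lt_top)
      localEnergy := ⟨Gu, hGu, fun K hK _ => (lintegral_mono_set hK).trans_lt hGu2, ?_⟩ }
  intro φ hφ hφ0
  obtain ⟨C, hC0, hφC, -, -, -⟩ := hφ.exists_scalar_weights_bound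
  -- the drift local energy inequalities of the `vₖ`, in set-integral form
  have hk : ∀ k, IntegrableOn (fun z : ℝ × E => frobeniusNormSq (G k z.1 z.2) * φ z.1 z.2) S volume ∧
      2 * ν * ∫ z, frobeniusNormSq (G k z.1 z.2) * φ z.1 z.2 ∂μQ ≤
        ∫ z, (‖v k z.1 z.2‖ ^ 2 * (timeDeriv φ z.1 z.2 + ν * Δ (φ z.1) z.2) +
          ‖v k z.1 z.2‖ ^ 2 * ⟪b k z.1 z.2, gradient (φ z.1) z.2⟫ +
          2 * π k z.1 z.2 * ⟪v k z.1 z.2, gradient (φ z.1) z.2⟫) ∂μQ := by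
    intro k
    obtain ⟨hIk, hineq⟩ := hleik k φ hφ hφ0
    refine ⟨hIk, ?_⟩
    rw [integral_integral_frobeniusNormSq_mul_eq hφ hIk,
      integral_integral_drift_lei_rhs_eq hQ ν (hv3 k) (hb3 k) (hπmem k).1 hφ] at hineq
    exact hineq
  -- convergence of the right-hand sides
  have hR := tendsto_setIntegral_drift_lei_rhs (μ := μQ) ν hφ hMt hv3 hb3 hu3 hconv hconvb hπm
    (fun k => (hπmem k).2) hpmem.1 hπw
  set Ru : ℝ := ∫ z, (‖u z.1 z.2‖ ^ 2 * (timeDeriv φ z.1 z.2 + ν * Δ (φ z.1) z.2) +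
    (‖u z.1 z.2‖ ^ 2 + 2 * p z.1 z.2) * ⟪u z.1 z.2, gradient (φ z.1) z.2⟫) ∂μQ with hRu
  have hRu' : ∫ z, (‖u z.1 z.2‖ ^ 2 * (timeDeriv φ z.1 z.2 + ν * Δ (φ z.1) z.2) +
      ‖u z.1 z.2‖ ^ 2 * ⟪u z.1 z.2, gradient (φ z.1) z.2⟫ +
      2 * p z.1 z.2 * ⟪u z.1 z.2, gradient (φ z.1) z.2⟫) ∂μQ = Ru := by
    rw [hRu]
    refine integral_congr_ae (Eventually.of_forall fun z => ?_)
    ring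
  rw [hRu'] at hR
  -- `|Gu|² φ` is integrable on `Q`
  have hGum : AEStronglyMeasurable (uncurry Gu) μQ := hGu.locallyIntegrableOn_grad.aestronglyMeasurable
  have hφm : AEStronglyMeasurable (uncurry φ) μQ := hφ.contDiff.continuous.aestronglyMeasurable
  have hfrobm : AEStronglyMeasurable (fun z : ℝ × E => frobeniusNormSq (Gu z.1 z.2)) μQ :=
    LerayHopfProofs.continuous_frobeniusNormSq.comp_aestronglyMeasurable hGum
  have hIGu : IntegrableOn (fun z : ℝ × E => frobeniusNormSq (Gu z.1 z.2) * φ z.1 z.2) S volume := by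
    have hf : Integrable (fun z : ℝ × E => frobeniusNormSq (Gu z.1 z.2)) μQ := by
      refine ⟨hfrobm, ?_⟩
      rw [hasFiniteIntegral_iff_enorm]
      refine lt_of_le_of_lt (lintegral_mono fun z => ?_) hGu2
      rw [Real.enorm_eq_ofReal (frobeniusNormSq_nonneg _)]
    refine (hf.mul_const C).mono' (hfrobm.mul hφm) (Eventually.of_forall fun z => ?_)
    rw [norm_mul, Real.norm_of_nonneg (frobeniusNormSq_nonneg _)]
    exact mul_le_mul_of_nonneg_left (hφC z) (frobeniusNormSq_nonneg _)
  -- pass to set integrals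
  rw [integral_integral_frobeniusNormSq_mul_eq hφ hIGu, integral_integral_lei_rhs_eq hQ ν hu3 hpmem.1 hφ]
  change 2 * ν * ∫ z, frobeniusNormSq (Gu z.1 z.2) * φ z.1 z.2 ∂μQ ≤ Ru
  -- nonnegativity of the right-hand sides
  have hRk0 : ∀ k, 0 ≤ ∫ z, (‖v k z.1 z.2‖ ^ 2 * (timeDeriv φ z.1 z.2 + ν * Δ (φ z.1) z.2) +
      ‖v k z.1 z.2‖ ^ 2 * ⟪b k z.1 z.2, gradient (φ z.1) z.2⟫ +
      2 * π k z.1 z.2 * ⟪v k z.1 z.2, gradient (φ z.1) z.2⟫) ∂μQ := fun k => by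
    refine le_trans ?_ (hk k).2
    exact mul_nonneg (mul_nonneg zero_le_two hν)
      (integral_nonneg fun z => mul_nonneg (frobeniusNormSq_nonneg _) (hφ0 _ _))
  have hRu0 : 0 ≤ Ru := ge_of_tendsto' hR hRk0
  rcases hν.eq_or_lt with hν0 | hνpos
  · rw [← hν0, mul_zero, zero_mul]
    exact hRu0
  -- `ν > 0`: weak lower semicontinuity for every `ε > 0`
  have h2ν : 0 < 2 * ν := by positivity
  set I : ℝ := ∫ z, frobeniusNormSq (Gu z.1 z.2) * φ z.1 z.2 ∂μQ with hI
  suffices hmain : ∀ ε, 0 < ε → 2 * ν * I ≤ Ru + ε from le_of_forall_pos_le_add hmain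
  intro ε hε
  set B : ℝ≥0∞ := ENNReal.ofReal ((Ru + ε) / (2 * ν)) with hB
  have hGm' : ∀ k, AEStronglyMeasurable (uncurry (G k)) μQ := hGm
  have hev : ∀ᶠ k in atTop, ∫⁻ z, ENNReal.ofReal (frobeniusNormSq (uncurry (G k) z) * uncurry φ z) ∂μQ
      ≤ B := by
    filter_upwards [(tendsto_order.1 hR).2 (Ru + ε) (lt_add_of_pos_right _ hε)] with k hklt
    have hint : Integrable (fun z : ℝ × E => frobeniusNormSq (G k z.1 z.2) * φ z.1 z.2) μQ := (hk k).1
    have hnn : 0 ≤ᵐ[μQ] fun z : ℝ × E => frobeniusNormSq (G k z.1 z.2) * φ z.1 z.2 :=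
      Eventually.of_forall fun z => mul_nonneg (frobeniusNormSq_nonneg _) (hφ0 _ _)
    have e := ofReal_integral_eq_lintegral_ofReal hint hnn
    change ∫⁻ z, ENNReal.ofReal (frobeniusNormSq (G k z.1 z.2) * φ z.1 z.2) ∂μQ ≤ B
    rw [← e, hB]
    refine ENNReal.ofReal_le_ofReal ?_
    rw [le_div_iff₀ h2ν, mul_comm]
    exact (hk k).2.trans hklt.le
  have hlsc := lintegral_frobeniusNormSq_mul_le_of_tendsto (μ := μQ) (G := fun k => uncurry (G k))
    (Gu := uncurry Gu) (φ := uncurry φ) (C := C) hGm' hGum hGu2 hφm (fun z => hφ0 _ _)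
    (fun z => (le_abs_self _).trans ((Real.norm_eq_abs _).symm.le.trans (hφC z))) hGw hev
  -- back to real numbers
  have hnn : 0 ≤ᵐ[μQ] fun z : ℝ × E => frobeniusNormSq (Gu z.1 z.2) * φ z.1 z.2 :=
    Eventually.of_forall fun z => mul_nonneg (frobeniusNormSq_nonneg _) (hφ0 _ _)
  have e := ofReal_integral_eq_lintegral_ofReal hIGu hnn
  change ∫⁻ z, ENNReal.ofReal (frobeniusNormSq (Gu z.1 z.2) * φ z.1 z.2) ∂μQ ≤ B at hlsc
  rw [← e, hB, ENNReal.ofReal_le_ofReal_iff (div_nonneg (by linarith) h2ν.le)] at hlsc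
  rw [mul_comm, ← le_div_iff₀ h2ν]
  exact hlsc

end Stability

end Literature.Analysis.FluidPDE

end
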